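import Literature.NumberTheory.Sieve.SmoothCountSaddleCore
import HarnessLib

/-!
# The Gaussian-smoothed saddle-point evaluation of `Ψ(x, y)`: analytic core for an arbitrary saddle point

Topic `Literature/NumberTheory/Sieve`; a PROVED tool file, companion of `SmoothCountSaddleCore` toward
`Literature.NumberTheory.Sieve.HTLocalBehaviour` [HildebrandTenenbaum1986, Thm 3] in the range of small
`y < 8 (log x)³`, where the saddle point `α = α(x, y)` may be small (`α ≍ π(y)/log x` when `y ≤ log x`).
`GaussSaddle.abs_rpow_mul_card_sub_main_le` assumes `3/5 ≤ α` and `α log y ≥ 1` through the Gaussian decay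
`|ζ(α+it, y)/ζ(α, y)| ≤ e^{-t²φ₂/100}` near the axis; here that input is replaced by the general near-axis
bound `≤ (1 + a t²)^{-K/2}` (`|t| ≤ π/log y`; the tree's `norm_smoothZetaC_le_mul_rpow_of_mul_log_le_one`,
`…_of_one_le_mul_log` give it with `aK = 4φ₂/π²`-type parameters in both regimes `α log y ≶ 1`), and the
kernel `A(t) = e^{-t²/2T²}/(α + it)` is bounded by `1/|t|` (not `1/α`) off the axis:

* `rpow_neg_half_le_two_shapes` — `(1 + a t²)^{-K/2} ≤ e^{-(aK/4)t²} + 2·2^{-K/2}/(1 + a t²)` (`K ≥ 2`), whence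
  `∫ (1 + a t²)^{-K/2} ≤ √(4π/(aK)) + 2π 2^{-K/2}/√a` (`integral_norm_le_general`, the Gaussian mean of `|ζ|`);
* `norm_setIntegral_compl_le_four` — the tail frame with four shapes;
* `norm_tailIntegral_le_general` — `‖∫_{[-τ,τ]ᶜ} f_A‖ ≤ (1+aτ²)^{-K/4}(√(8π/(aK)) + 2^{1-K/4}π/√a)/α`
  `+ 6 ε₁ log y + (2π/3) ε₂ T + 2π B₃/T²` (`K ≥ 4`; regions `τ < |t| ≤ π/log y`, `≤ 3`, `≤ T`, `> T`);
* `abs_rpow_mul_card_sub_main_le_general` — the analogue of `GaussSaddle.abs_rpow_mul_card_sub_main_le`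
  for every `0 < α ≤ 1`.

## References

* [HildebrandTenenbaum1986] A. Hildebrand, G. Tenenbaum, Trans. AMS 296 (1986) 265–290, §3 Lemma 8,
  §4 Lemmas 10–11, §5.
-/

noncomputable section

open Complex MeasureTheory Real Set Filter

namespace Literature.NumberTheory.Sieve

namespace GaussSaddle

variable {α T t x : ℝ} {y : ℕ}

/-! ### Kernel bound off the axis -/

/-- `|A(t)| ≤ 1/|t|` for `t ≠ 0`. [folklore] -/
theorem norm_kernelA_le_abs_inv (α T : ℝ) (ht : t ≠ 0) : ‖kernelA α T t‖ ≤ |t|⁻¹ := by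
  rw [norm_kernelA]
  have h1 := norm_inv_add_mul_I_le_abs α ht
  have h2 : Real.exp (-(t ^ 2 / (2 * T ^ 2))) ≤ 1 := Real.exp_le_one_iff.2 (neg_nonpos.2 (by positivity))
  calc Real.exp (-(t ^ 2 / (2 * T ^ 2))) * ‖((α : ℂ) + t * I)⁻¹‖ ≤ 1 * |t|⁻¹ :=
        mul_le_mul h2 h1 (norm_nonneg _) zero_le_one
    _ = |t|⁻¹ := one_mul _

/-! ### The two-shape majorant of `(1 + a t²)^{-K/2}` -/

/-- `(1 + a t²)^{-K/2} ≤ e^{-(aK/4) t²} + 2 · 2^{-K/2}/(1 + a t²)` for `a > 0`, `K ≥ 2`: for `a t² ≤ 1` use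
`log(1 + v) ≥ v/2`, otherwise `(1 + v)^{-(K/2 - 1)} ≤ 2^{-(K/2 - 1)}`. [folklore] -/
theorem rpow_neg_half_le_two_shapes {a K : ℝ} (ha : 0 < a) (hK : 2 ≤ K) (t : ℝ) :
    (1 + a * t ^ 2) ^ (-(K / 2)) ≤
      Real.exp (-(a * K / 4) * t ^ 2) + 2 * (2 : ℝ) ^ (-(K / 2)) / (1 + a * t ^ 2) := by
  set v : ℝ := a * t ^ 2 with hv
  have hv0 : 0 ≤ v := by positivity
  have h1v : 0 < 1 + v := by linarith
  have hexp0 : 0 < Real.exp (-(a * K / 4) * t ^ 2) := Real.exp_pos _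
  have hsec0 : 0 ≤ 2 * (2 : ℝ) ^ (-(K / 2)) / (1 + v) := by positivity
  rcases le_or_gt v 1 with hv1 | hv1
  · -- `log(1 + v) ≥ v/(1+v) ≥ v/2`
    have hlog : v / 2 ≤ Real.log (1 + v) := by
      have h := Real.one_sub_inv_le_log_of_pos h1v
      have h2 : v / 2 ≤ 1 - (1 + v)⁻¹ := by
        rw [show 1 - (1 + v)⁻¹ = v / (1 + v) by field_simp; ring]
        exact div_le_div_of_nonneg_left hv0 h1v (by linarith)
      linarith
    have h1 : (1 + v) ^ (-(K / 2)) ≤ Real.exp (-(a * K / 4) * t ^ 2) := by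
      rw [Real.rpow_def_of_pos h1v]
      refine Real.exp_le_exp.2 ?_
      have hK0 : 0 ≤ K / 2 := by linarith
      have := mul_le_mul_of_nonneg_left hlog hK0
      have e : -(a * K / 4) * t ^ 2 = -(K / 2 * (v / 2)) := by rw [hv]; ring
      rw [e]; nlinarith
    linarith
  · have hsplit : (1 + v) ^ (-(K / 2)) = (1 + v) ^ (-1 : ℝ) * (1 + v) ^ (-(K / 2 - 1)) := by
      rw [← Real.rpow_add h1v]; ring_nf
    have h2 : (1 + v) ^ (-(K / 2 - 1)) ≤ (2 : ℝ) ^ (-(K / 2 - 1)) :=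
      Real.rpow_le_rpow_of_nonpos (by norm_num) (by linarith) (by linarith)
    have h3 : (2 : ℝ) ^ (-(K / 2 - 1)) = 2 * (2 : ℝ) ^ (-(K / 2)) := by
      rw [show -(K / 2 - 1) = 1 + -(K / 2) by ring, Real.rpow_add (by norm_num), Real.rpow_one]
    have h4 : (1 + v) ^ (-1 : ℝ) = 1 / (1 + v) := by
      rw [Real.rpow_neg h1v.le, Real.rpow_one, one_div]
    rw [hsplit, h4]
    have h5 : 1 / (1 + v) * (1 + v) ^ (-(K / 2 - 1)) ≤ 1 / (1 + v) * (2 * (2 : ℝ) ^ (-(K / 2))) := by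
      rw [← h3]; exact mul_le_mul_of_nonneg_left h2 (by positivity)
    rw [show 1 / (1 + v) * (2 * (2 : ℝ) ^ (-(K / 2))) = 2 * (2 : ℝ) ^ (-(K / 2)) / (1 + v) by ring] at h5
    linarith

/-- The Cauchy shape of the second term: `2·2^{-K/2}/(1 + a t²) = (2·2^{-K/2}/a)/((1/√a)² + t²)`. [folklore] -/
theorem two_shapes_cauchy_eq {a K : ℝ} (ha : 0 < a) (t : ℝ) :
    2 * (2 : ℝ) ^ (-(K / 2)) / (1 + a * t ^ 2) = (2 * (2 : ℝ) ^ (-(K / 2)) / a) / ((1 / Real.sqrt a) ^ 2 + t ^ 2) := by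
  have hsq : (1 / Real.sqrt a) ^ 2 = 1 / a := by rw [div_pow, one_pow, Real.sq_sqrt ha.le]
  rw [hsq]
  field_simp

/-! ### The Gaussian mean of `|ζ(α + it, y)|`, general near-axis input -/

/-- **The Gaussian mean of `|ζ|` from three-zone bounds, general near-axis form.** If `|ζ(α + it, y)| ≤ ζ₀`
always, `≤ ζ₀ (1 + a t²)^{-K/2}` for `|t| ≤ π/L` (`a > 0`, `K ≥ 2`) and `≤ ζ₀ ε` for `π/L ≤ |t| ≤ T_d`, then
`∫ e^{-8π²ξ²/T²} |ζ(α + 2πiξ, y)| dξ ≤ (ζ₀/2π)(√(4π/(aK)) + 2π 2^{-K/2}/√a + 2εT_d + e^{-T_d²/T²} √(πT²))`.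
[cite: HildebrandTenenbaum1986, §4 Lemma 9 and (4.6)] -/
theorem integral_norm_le_general (α : ℝ) (hT : 0 < T) {a K ε Td L ζ₀ : ℝ} (ha : 0 < a) (hK : 2 ≤ K)
    (hε : 0 ≤ ε) (hTd : 0 < Td) (hζ : 0 ≤ ζ₀) (hall : ∀ t : ℝ, ‖smoothZetaC ((α : ℂ) + t * I) y‖ ≤ ζ₀)
    (hnear : ∀ t : ℝ, |t| ≤ Real.pi / L →
      ‖smoothZetaC ((α : ℂ) + t * I) y‖ ≤ ζ₀ * (1 + a * t ^ 2) ^ (-(K / 2)))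
    (hmid : ∀ t : ℝ, Real.pi / L ≤ |t| → |t| ≤ Td → ‖smoothZetaC ((α : ℂ) + t * I) y‖ ≤ ζ₀ * ε) :
    ∫ ξ : ℝ, ‖GaussPerron.perronDamping (T / 2) ξ‖ * ‖smoothZetaC ((α : ℂ) + 2 * Real.pi * ξ * I) y‖ ≤
      1 / (2 * Real.pi) * (ζ₀ * (Real.sqrt (Real.pi / (a * K / 4)) +
        (2 * (2 : ℝ) ^ (-(K / 2)) / a) * Real.pi / (1 / Real.sqrt a) + ε * (2 * Td) +
        Real.exp (-(Td ^ 2 / T ^ 2)) * Real.sqrt (Real.pi / (1 / T ^ 2)))) := by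
  set h : ℝ → ℝ := fun t => Real.exp (-(2 * t ^ 2 / T ^ 2)) * ‖smoothZetaC ((α : ℂ) + t * I) y‖ with hh
  have hpt : ∀ ξ : ℝ, ‖GaussPerron.perronDamping (T / 2) ξ‖ * ‖smoothZetaC ((α : ℂ) + 2 * Real.pi * ξ * I) y‖ =
      h (2 * Real.pi * ξ) := by
    intro ξ
    simp only [hh, GaussPerron.norm_perronDamping]
    congr 1
    · congr 1; field_simp
    · push_cast; ring_nf
  simp_rw [hpt]
  rw [Measure.integral_comp_mul_left h (2 * Real.pi), smul_eq_mul, abs_of_pos (inv_pos.2 (by positivity)), one_div]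
  refine mul_le_mul_of_nonneg_left ?_ (inv_nonneg.2 (by positivity))
  have haK : 0 < a * K / 4 := by have : (0 : ℝ) < K := by linarith
                                 positivity
  have ha₀ : 0 < 1 / Real.sqrt a := by positivity
  set B : ℝ := 2 * (2 : ℝ) ^ (-(K / 2)) / a with hB
  have hB0 : 0 ≤ B := by positivity
  -- the majorant
  set M : ℝ → ℝ := fun t => ζ₀ * (Real.exp (-(a * K / 4) * t ^ 2) + B / ((1 / Real.sqrt a) ^ 2 + t ^ 2) +
    ε * (Set.Icc (-Td) Td).indicator 1 t + Real.exp (-(Td ^ 2 / T ^ 2)) * Real.exp (-(1 / T ^ 2) * t ^ 2)) with hM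
  have hi1 : Integrable fun t : ℝ => Real.exp (-(a * K / 4) * t ^ 2) := integrable_exp_neg_mul_sq haK
  have hi2 : Integrable fun t : ℝ => B / ((1 / Real.sqrt a) ^ 2 + t ^ 2) := integrable_const_div_sq_add_sq ha₀ B
  have hi3 : Integrable fun t : ℝ => ε * (Set.Icc (-Td) Td).indicator (1 : ℝ → ℝ) t :=
    ((integrableOn_const (by simp [Real.volume_Icc])).integrable_indicator measurableSet_Icc).const_mul ε
  have hi4 : Integrable fun t : ℝ => Real.exp (-(Td ^ 2 / T ^ 2)) * Real.exp (-(1 / T ^ 2) * t ^ 2) :=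
    (integrable_exp_neg_mul_sq (by positivity)).const_mul _
  have hi12 : Integrable fun t : ℝ => Real.exp (-(a * K / 4) * t ^ 2) + B / ((1 / Real.sqrt a) ^ 2 + t ^ 2) :=
    hi1.add hi2
  have hi123 : Integrable fun t : ℝ => Real.exp (-(a * K / 4) * t ^ 2) + B / ((1 / Real.sqrt a) ^ 2 + t ^ 2) +
      ε * (Set.Icc (-Td) Td).indicator (1 : ℝ → ℝ) t := hi12.add hi3
  have hMint : Integrable M := (hi123.add hi4).const_mul ζ₀
  have hMval : ∫ t, M t = ζ₀ * (Real.sqrt (Real.pi / (a * K / 4)) + B * Real.pi / (1 / Real.sqrt a) + ε * (2 * Td) +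
      Real.exp (-(Td ^ 2 / T ^ 2)) * Real.sqrt (Real.pi / (1 / T ^ 2))) := by
    simp only [hM]
    rw [integral_const_mul, integral_add hi123 hi4, integral_add hi12 hi3,
      integral_add hi1 hi2, integral_gaussian, integral_const_div_sq_add_sq ha₀, integral_const_mul,
      integral_const_mul, integral_gaussian, integral_indicator measurableSet_Icc]
    have hI : ∫ x in Set.Icc (-Td) Td, (1 : ℝ → ℝ) x = 2 * Td := by
      simp only [Pi.one_apply, setIntegral_const, smul_eq_mul, mul_one]
      rw [Real.volume_real_Icc_of_le (by linarith)]; ring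
    rw [hI]
  rw [← hMval]
  refine integral_mono_of_nonneg (Eventually.of_forall fun t => by positivity) hMint
    (Eventually.of_forall fun t => ?_)
  -- pointwise `h ≤ M`
  simp only [hh, hM]
  have hexp1 : Real.exp (-(2 * t ^ 2 / T ^ 2)) ≤ 1 := Real.exp_le_one_iff.2 (neg_nonpos.2 (by positivity))
  have hg1 : 0 ≤ Real.exp (-(a * K / 4) * t ^ 2) := (Real.exp_pos _).le
  have hg1' : 0 ≤ B / ((1 / Real.sqrt a) ^ 2 + t ^ 2) := by positivity
  have hg2 : 0 ≤ ε * (Set.Icc (-Td) Td).indicator (1 : ℝ → ℝ) t :=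
    mul_nonneg hε (Set.indicator_nonneg (fun _ _ => zero_le_one) t)
  have hg3 : 0 ≤ Real.exp (-(Td ^ 2 / T ^ 2)) * Real.exp (-(1 / T ^ 2) * t ^ 2) := by positivity
  have hn0 : 0 ≤ ‖smoothZetaC ((α : ℂ) + t * I) y‖ := norm_nonneg _
  rcases le_or_gt |t| (Real.pi / L) with ht1 | ht1
  · -- near the axis: the two-shape majorant
    have h1 := hnear t ht1
    have h2 := rpow_neg_half_le_two_shapes ha hK t
    rw [two_shapes_cauchy_eq ha, ← hB] at h2
    calc Real.exp (-(2 * t ^ 2 / T ^ 2)) * ‖smoothZetaC ((α : ℂ) + t * I) y‖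
        ≤ 1 * (ζ₀ * (1 + a * t ^ 2) ^ (-(K / 2))) := mul_le_mul hexp1 h1 hn0 zero_le_one
      _ ≤ ζ₀ * (Real.exp (-(a * K / 4) * t ^ 2) + B / ((1 / Real.sqrt a) ^ 2 + t ^ 2)) := by
          rw [one_mul]; exact mul_le_mul_of_nonneg_left h2 hζ
      _ ≤ _ := by nlinarith [mul_nonneg hζ hg2, mul_nonneg hζ hg3]
  · rcases le_or_gt |t| Td with ht2 | ht2
    · have h1 := hmid t ht1.le ht2
      have hind : (Set.Icc (-Td) Td).indicator (1 : ℝ → ℝ) t = 1 := by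
        rw [Set.indicator_of_mem (Set.mem_Icc.2 (abs_le.1 ht2)), Pi.one_apply]
      rw [hind]
      calc Real.exp (-(2 * t ^ 2 / T ^ 2)) * ‖smoothZetaC ((α : ℂ) + t * I) y‖
          ≤ 1 * (ζ₀ * ε) := mul_le_mul hexp1 h1 hn0 zero_le_one
        _ ≤ _ := by nlinarith [mul_nonneg hζ hg1, mul_nonneg hζ hg1', mul_nonneg hζ hg3]
    · have h1 := hall t
      have hsq : Td ^ 2 ≤ t ^ 2 := by rw [← sq_abs t]; exact pow_le_pow_left₀ hTd.le ht2.le 2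
      have hexp2 : Real.exp (-(2 * t ^ 2 / T ^ 2)) ≤ Real.exp (-(Td ^ 2 / T ^ 2)) * Real.exp (-(1 / T ^ 2) * t ^ 2) := by
        rw [← Real.exp_add]
        refine Real.exp_le_exp.2 ?_
        have hT2 : 0 < T ^ 2 := by positivity
        rw [show -(2 * t ^ 2 / T ^ 2) = -(t ^ 2 / T ^ 2) + -(t ^ 2 / T ^ 2) by ring,
          show -(1 / T ^ 2) * t ^ 2 = -(t ^ 2 / T ^ 2) by ring]
        have : Td ^ 2 / T ^ 2 ≤ t ^ 2 / T ^ 2 := div_le_div_of_nonneg_right hsq hT2.le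
        linarith
      calc Real.exp (-(2 * t ^ 2 / T ^ 2)) * ‖smoothZetaC ((α : ℂ) + t * I) y‖
          ≤ (Real.exp (-(Td ^ 2 / T ^ 2)) * Real.exp (-(1 / T ^ 2) * t ^ 2)) * ζ₀ :=
            mul_le_mul hexp2 h1 hn0 hg3
        _ ≤ _ := by nlinarith [mul_nonneg hζ hg1, mul_nonneg hζ hg1', mul_nonneg hζ hg2]

/-! ### The tails, general near-axis input -/

/-- **Tail estimate with four shapes.** If off a measurable set `s` an integrable `f : ℝ → ℂ` is dominated by
`A e^{-bt²} + B/(a² + t²) + B'/(a'² + t²) + C/(T² + t²)`, then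
`‖∫_{sᶜ} f‖ ≤ A √(π/b) + Bπ/a + B'π/a' + Cπ/T`. [folklore] -/
theorem norm_setIntegral_compl_le_four {f : ℝ → ℂ} {s : Set ℝ} (hs : MeasurableSet s) (hf : Integrable f)
    {A b B a B' a' C T : ℝ} (hb : 0 < b) (ha : 0 < a) (ha' : 0 < a') (hT : 0 < T) (hA : 0 ≤ A) (hB : 0 ≤ B)
    (hB' : 0 ≤ B') (hC : 0 ≤ C)
    (hbound : ∀ t, t ∉ s → ‖f t‖ ≤ A * Real.exp (-b * t ^ 2) + B / (a ^ 2 + t ^ 2) + B' / (a' ^ 2 + t ^ 2) +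
      C / (T ^ 2 + t ^ 2)) :
    ‖∫ t in sᶜ, f t‖ ≤ A * Real.sqrt (Real.pi / b) + B * Real.pi / a + B' * Real.pi / a' + C * Real.pi / T := by
  set G : ℝ → ℝ := fun t => A * Real.exp (-b * t ^ 2) + B / (a ^ 2 + t ^ 2) + B' / (a' ^ 2 + t ^ 2) +
    C / (T ^ 2 + t ^ 2) with hG
  have hG1 : Integrable fun t : ℝ => A * Real.exp (-b * t ^ 2) := (integrable_exp_neg_mul_sq hb).const_mul A
  have hG2 : Integrable fun t : ℝ => B / (a ^ 2 + t ^ 2) := integrable_const_div_sq_add_sq ha B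
  have hG2' : Integrable fun t : ℝ => B' / (a' ^ 2 + t ^ 2) := integrable_const_div_sq_add_sq ha' B'
  have hG3 : Integrable fun t : ℝ => C / (T ^ 2 + t ^ 2) := integrable_const_div_sq_add_sq hT C
  have hG12 : Integrable fun t : ℝ => A * Real.exp (-b * t ^ 2) + B / (a ^ 2 + t ^ 2) := hG1.add hG2
  have hG123 : Integrable fun t : ℝ => A * Real.exp (-b * t ^ 2) + B / (a ^ 2 + t ^ 2) + B' / (a' ^ 2 + t ^ 2) :=
    hG12.add hG2'
  have hGint : Integrable G := hG123.add hG3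
  have hGnonneg : ∀ t, 0 ≤ G t := fun t => by simp only [hG]; positivity
  calc ‖∫ t in sᶜ, f t‖ ≤ ∫ t in sᶜ, ‖f t‖ := norm_integral_le_integral_norm _
    _ ≤ ∫ t in sᶜ, G t :=
        setIntegral_mono_on hf.norm.integrableOn hGint.integrableOn hs.compl fun t ht => hbound t ht
    _ ≤ ∫ t, G t := setIntegral_le_integral hGint (Filter.Eventually.of_forall hGnonneg)
    _ = A * Real.sqrt (Real.pi / b) + B * Real.pi / a + B' * Real.pi / a' + C * Real.pi / T := by
        simp only [hG]
        rw [integral_add hG123 hG3, integral_add hG12 hG2', integral_add hG1 hG2,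
          integral_const_mul, integral_gaussian, integral_const_div_sq_add_sq ha,
          integral_const_div_sq_add_sq ha', integral_const_div_sq_add_sq hT]

set_option maxHeartbeats 1600000 in
/-- **The tails off the window `τ = W/√φ₂`, arbitrary saddle point.** Let `0 < α = α(x, y)`,
`φ = φ₂(α, y)`, `τ = W/√φ` (`W > 0`), `π/log y ≤ 1`, `A(t) = e^{-t²/2T_g²}/(α + it)`; suppose the near-axis bound
`|ζ(α+it, y)| ≤ ζ(α, y)(1 + a t²)^{-K/2}` for `|t| ≤ π/log y` (`a > 0`, `K ≥ 4`), the decay `≤ ε₁` of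
`ζ(α+it, y)/ζ(α, y)` for `π/log y ≤ |t| ≤ 3` and `≤ ε₂` for `3 ≤ |t| ≤ T` (`T ≥ 3`), and `‖A t‖ ≤ B₃/|t|³` for
`|t| > T`. Then `‖∫_{[-τ,τ]ᶜ} f_A‖ ≤ (1 + aτ²)^{-K/4}(√(8π/(aK)) + 2^{1-K/4}π/√a)/α + 6 ε₁ log y`
`+ (2π/3) ε₂ T + 2π B₃/T²` (regions: near the axis `(1 + a t²)^{-K/2} ≤ (1 + aτ²)^{-K/4}(1 + at²)^{-K/4}` with
the two-shape majorant at `K/2` and `‖A‖ ≤ 1/α`; then `‖A‖ ≤ 1/|t| ≤ log y/π ≤ (18 log y/π)/(9 + t²)`; then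
`‖A‖ ≤ 1/3 ≤ (2T²/3)/(T² + t²)`; then `B₃/|t|³ ≤ (2B₃/T)/(T² + t²)`).
[cite: HildebrandTenenbaum1986, §4 (Lemma 10)] -/
theorem norm_tailIntegral_le_general {x Tg T ε₁ ε₂ B₃ W a K : ℝ} {y : ℕ} (hx : 1 < x) (hy : 2 ≤ y)
    (hφ0 : 0 < saddlePhi₂ (saddlePoint x y) y) (hTg : 0 < Tg)
    (hW : 0 < W)
    (hy1 : Real.pi / Real.log y ≤ 1) (hT : 3 ≤ T) (hε₁ : 0 ≤ ε₁) (hε₂ : 0 ≤ ε₂) (ha : 0 < a) (hK : 4 ≤ K)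
    (hnear : ∀ t : ℝ, |t| ≤ Real.pi / Real.log y →
      ‖smoothZetaC ((saddlePoint x y : ℂ) + t * I) y‖ ≤ smoothZeta (saddlePoint x y) y * (1 + a * t ^ 2) ^ (-(K / 2)))
    (hdec1 : ∀ t : ℝ, Real.pi / Real.log y ≤ |t| → |t| ≤ 3 →
      ‖smoothZetaC ((saddlePoint x y : ℂ) + t * I) y‖ / smoothZeta (saddlePoint x y) y ≤ ε₁)
    (hdec2 : ∀ t : ℝ, 3 ≤ |t| → |t| ≤ T →
      ‖smoothZetaC ((saddlePoint x y : ℂ) + t * I) y‖ / smoothZeta (saddlePoint x y) y ≤ ε₂)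
    (hB₃ : 0 ≤ B₃) (hB3 : ∀ t : ℝ, T < |t| → ‖kernelA (saddlePoint x y) Tg t‖ ≤ B₃ / |t| ^ 3) :
    ‖∫ t in (Icc (-(W / Real.sqrt (saddlePhi₂ (saddlePoint x y) y))) (W / Real.sqrt (saddlePhi₂ (saddlePoint x y) y)))ᶜ,
        SaddleKernel.kernelIntegrand x (saddlePoint x y) y (kernelA (saddlePoint x y) Tg) t‖ ≤
      (1 + a * (W / Real.sqrt (saddlePhi₂ (saddlePoint x y) y)) ^ 2) ^ (-(K / 4)) *
          (Real.sqrt (8 * Real.pi / (a * K)) + 2 * (2 : ℝ) ^ (-(K / 4)) * Real.pi / Real.sqrt a) / saddlePoint x y +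
        6 * ε₁ * Real.log y + 2 * Real.pi / 3 * ε₂ * T + 2 * Real.pi * B₃ / T ^ 2 := by
  set α : ℝ := saddlePoint x y with hαdef
  have hα0 : 0 < α := saddlePoint_pos hx hy
  set φ : ℝ := saddlePhi₂ α y with hφ
  set Φ : ℝ := Real.sqrt φ with hΦ
  have hΦ0 : 0 < Φ := Real.sqrt_pos.mpr hφ0
  set τ : ℝ := W / Φ with hτdef
  have hτ0 : 0 < τ := by positivity
  set L : ℝ := Real.log y with hL
  have hL0 : 0 < L := Real.log_pos (by exact_mod_cast lt_of_lt_of_le one_lt_two hy)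
  have hT0 : 0 < T := by linarith
  have hπ0 := Real.pi_pos
  have hπ3 := Real.pi_gt_three
  set A : ℝ → ℂ := kernelA α Tg with hA
  have hAc : Continuous A := continuous_kernelA hα0 Tg
  have hAi : Integrable A := integrable_kernelA hα0 hTg
  -- constants of the four shapes
  have hK2 : 2 ≤ K / 2 := by linarith
  set D : ℝ := (1 + a * τ ^ 2) ^ (-(K / 4)) with hD
  have hD0 : 0 < D := Real.rpow_pos_of_pos (by positivity) _
  set A' : ℝ := D / α with hA'
  have hA'0 : 0 ≤ A' := by positivity
  set b : ℝ := a * (K / 2) / 4 with hb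
  have hb0 : 0 < b := by positivity
  set B : ℝ := D / α * (2 * (2 : ℝ) ^ (-(K / 2 / 2)) / a) with hB
  have hB0 : 0 ≤ B := by positivity
  set a₀ : ℝ := 1 / Real.sqrt a with ha₀
  have ha₀0 : 0 < a₀ := by positivity
  set B' : ℝ := 18 * ε₁ * L / Real.pi with hB'
  have hB'0 : 0 ≤ B' := by positivity
  set C : ℝ := 2 / 3 * ε₂ * T ^ 2 + 2 * B₃ / T with hC
  have hC0 : 0 ≤ C := by positivity
  -- ### the pointwise majorant off the window
  have hmaj : ∀ t, t ∉ Icc (-τ) τ → ‖SaddleKernel.kernelIntegrand x α y A t‖ ≤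
      A' * Real.exp (-b * t ^ 2) + B / (a₀ ^ 2 + t ^ 2) + B' / (3 ^ 2 + t ^ 2) + C / (T ^ 2 + t ^ 2) := by
    intro t ht
    have htabs : τ < |t| := by
      rw [mem_Icc, not_and_or, not_le, not_le] at ht
      rcases ht with h | h
      · rw [abs_of_neg (by linarith)]; linarith
      · exact lt_of_lt_of_le h (le_abs_self t)
    have htne : t ≠ 0 := by intro h; rw [h, abs_zero] at htabs; linarith
    have hnorm : ‖SaddleKernel.kernelIntegrand x α y A t‖ =
        ‖smoothZetaC ((α : ℂ) + t * I) y‖ / smoothZeta α y * ‖A t‖ :=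
      SaddleKernel.norm_kernelIntegrand_eq hα0 x y A t
    have hζ0 : 0 < smoothZeta α y := smoothZeta_pos hα0
    have hratio1 : ‖smoothZetaC ((α : ℂ) + t * I) y‖ / smoothZeta α y ≤ 1 := by
      rw [div_le_one hζ0]; exact norm_smoothZetaC_le hα0 t y
    have hratio0 : 0 ≤ ‖smoothZetaC ((α : ℂ) + t * I) y‖ / smoothZeta α y := by positivity
    have hAt_abs : ‖A t‖ ≤ |t|⁻¹ := norm_kernelA_le_abs_inv α Tg htne
    have hAt_α : ‖A t‖ ≤ 1 / α := norm_kernelA_le hα0 Tg t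
    have h4terms : 0 ≤ A' * Real.exp (-b * t ^ 2) ∧ 0 ≤ B / (a₀ ^ 2 + t ^ 2) ∧ 0 ≤ B' / (3 ^ 2 + t ^ 2) ∧
        0 ≤ C / (T ^ 2 + t ^ 2) := ⟨by positivity, by positivity, by positivity, by positivity⟩
    rcases le_or_gt |t| (Real.pi / L) with hI | hI
    · ---- near the axis: `(1 + at²)^{-K/2} ≤ D · (two shapes at K/2)`, `‖A‖ ≤ 1/α`
      have hrat : ‖smoothZetaC ((α : ℂ) + t * I) y‖ / smoothZeta α y ≤ (1 + a * t ^ 2) ^ (-(K / 2)) := by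
        rw [div_le_iff₀ hζ0]
        calc _ ≤ smoothZeta α y * (1 + a * t ^ 2) ^ (-(K / 2)) := hnear t hI
          _ = _ := mul_comm _ _
      have ht2 : τ ^ 2 ≤ t ^ 2 := by
        have h := pow_le_pow_left₀ hτ0.le htabs.le 2
        rwa [sq_abs] at h
      have hbase_t : 0 < 1 + a * t ^ 2 := by positivity
      -- `(1 + at²)^{-K/2} = (1 + at²)^{-K/4} (1 + at²)^{-K/4} ≤ D (1 + at²)^{-(K/2)/2}`
      have hsplit : (1 + a * t ^ 2) ^ (-(K / 2)) = (1 + a * t ^ 2) ^ (-(K / 4)) * (1 + a * t ^ 2) ^ (-(K / 2 / 2)) := by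
        rw [← Real.rpow_add hbase_t]; ring_nf
      have hfirst : (1 + a * t ^ 2) ^ (-(K / 4)) ≤ D := by
        rw [hD]
        exact Real.rpow_le_rpow_of_nonpos (by positivity) (by nlinarith) (by linarith)
      have htwo := rpow_neg_half_le_two_shapes ha hK2 t
      rw [two_shapes_cauchy_eq ha, ← ha₀] at htwo
      have hprod : (1 + a * t ^ 2) ^ (-(K / 2)) ≤
          D * (Real.exp (-(a * (K / 2) / 4) * t ^ 2) + (2 * (2 : ℝ) ^ (-(K / 2 / 2)) / a) / (a₀ ^ 2 + t ^ 2)) := by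
        rw [hsplit]
        exact mul_le_mul hfirst htwo (Real.rpow_nonneg hbase_t.le _) hD0.le
      calc ‖SaddleKernel.kernelIntegrand x α y A t‖
          = ‖smoothZetaC ((α : ℂ) + t * I) y‖ / smoothZeta α y * ‖A t‖ := hnorm
        _ ≤ (D * (Real.exp (-(a * (K / 2) / 4) * t ^ 2) + (2 * (2 : ℝ) ^ (-(K / 2 / 2)) / a) / (a₀ ^ 2 + t ^ 2))) *
              (1 / α) := mul_le_mul (hrat.trans hprod) hAt_α (norm_nonneg _) (by positivity)
        _ = A' * Real.exp (-b * t ^ 2) + B / (a₀ ^ 2 + t ^ 2) := by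
            rw [hA', hb, hB]; field_simp
        _ ≤ _ := by linarith [h4terms.2.2.1, h4terms.2.2.2]
    · rcases le_or_gt |t| 3 with hII | hII
      · ---- `π/L < |t| ≤ 3`: `‖A‖ ≤ 1/|t| ≤ L/π ≤ (18 L/π)/(9 + t²)`
        have hrat := hdec1 t hI.le hII
        have hAt : ‖A t‖ ≤ L / Real.pi := by
          refine hAt_abs.trans ?_
          rw [inv_eq_one_div, div_le_div_iff₀ (abs_pos.2 htne) hπ0]
          rw [div_lt_iff₀ hL0] at hI
          nlinarith
        have hden : 1 ≤ 18 / (3 ^ 2 + t ^ 2) := by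
          rw [le_div_iff₀ (by positivity)]
          have h9 : t ^ 2 ≤ 3 ^ 2 := by
            have h := pow_le_pow_left₀ (abs_nonneg t) hII 2
            rwa [sq_abs] at h
          linarith
        calc ‖SaddleKernel.kernelIntegrand x α y A t‖
            = ‖smoothZetaC ((α : ℂ) + t * I) y‖ / smoothZeta α y * ‖A t‖ := hnorm
          _ ≤ ε₁ * (L / Real.pi) := mul_le_mul hrat hAt (norm_nonneg _) hε₁
          _ ≤ ε₁ * (L / Real.pi) * (18 / (3 ^ 2 + t ^ 2)) := le_mul_of_one_le_right (by positivity) hden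
          _ = B' / (3 ^ 2 + t ^ 2) := by rw [hB']; field_simp
          _ ≤ _ := by linarith [h4terms.1, h4terms.2.1, h4terms.2.2.2]
      · rcases le_or_gt |t| T with hIII | hIII
        · ---- `3 < |t| ≤ T`: `‖A‖ ≤ 1/|t| ≤ 1/3 ≤ (2T²/3)/(T² + t²)`
          have hrat := hdec2 t hII.le hIII
          have hAt : ‖A t‖ ≤ 1 / 3 := by
            refine hAt_abs.trans ?_
            rw [inv_eq_one_div]
            exact div_le_div_of_nonneg_left zero_le_one (by norm_num) hII.le
          have hden : 1 ≤ 2 * T ^ 2 / (T ^ 2 + t ^ 2) := by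
            rw [le_div_iff₀ (by positivity)]
            have h9 : t ^ 2 ≤ T ^ 2 := by
              have h := pow_le_pow_left₀ (abs_nonneg t) hIII 2
              rwa [sq_abs] at h
            linarith
          calc ‖SaddleKernel.kernelIntegrand x α y A t‖
              = ‖smoothZetaC ((α : ℂ) + t * I) y‖ / smoothZeta α y * ‖A t‖ := hnorm
            _ ≤ ε₂ * (1 / 3) := mul_le_mul hrat hAt (norm_nonneg _) hε₂
            _ ≤ ε₂ * (1 / 3) * (2 * T ^ 2 / (T ^ 2 + t ^ 2)) := le_mul_of_one_le_right (by positivity) hden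
            _ ≤ C / (T ^ 2 + t ^ 2) := by
                rw [← mul_div_assoc]
                apply div_le_div_of_nonneg_right _ (by positivity)
                rw [hC]
                have : 0 ≤ 2 * B₃ / T := by positivity
                nlinarith
            _ ≤ _ := by linarith [h4terms.1, h4terms.2.1, h4terms.2.2.1]
        · ---- `|t| > T`: the decay of `A`
          have hAt : ‖A t‖ ≤ B₃ / |t| ^ 3 := hB3 t hIII
          have hden : B₃ / |t| ^ 3 ≤ (2 * B₃ / T) / (T ^ 2 + t ^ 2) := by
            have ht2 : T ^ 2 ≤ t ^ 2 := by
              have h := pow_le_pow_left₀ hT0.le hIII.le 2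
              rwa [sq_abs] at h
            have h1 : |t| ^ 3 = |t| * t ^ 2 := by rw [← sq_abs]; ring
            have h2 : T * (T ^ 2 + t ^ 2) ≤ 2 * (|t| * t ^ 2) := by
              nlinarith [mul_le_mul hIII.le ht2 (by positivity) (abs_nonneg t),
                mul_le_mul_of_nonneg_right hIII.le (sq_nonneg t)]
            have habs0 : 0 < |t| := lt_trans hT0 hIII
            rw [div_div, div_le_div_iff₀ (by positivity) (by positivity), h1]
            have := mul_le_mul_of_nonneg_left h2 hB₃
            nlinarith
          calc ‖SaddleKernel.kernelIntegrand x α y A t‖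
              = ‖smoothZetaC ((α : ℂ) + t * I) y‖ / smoothZeta α y * ‖A t‖ := hnorm
            _ ≤ 1 * (B₃ / |t| ^ 3) := mul_le_mul hratio1 hAt (norm_nonneg _) zero_le_one
            _ ≤ (2 * B₃ / T) / (T ^ 2 + t ^ 2) := by rw [one_mul]; exact hden
            _ ≤ C / (T ^ 2 + t ^ 2) := by
                apply div_le_div_of_nonneg_right _ (by positivity)
                rw [hC]; have : 0 ≤ 2 / 3 * ε₂ * T ^ 2 := by positivity
                linarith
            _ ≤ _ := by linarith [h4terms.1, h4terms.2.1, h4terms.2.2.1]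
  -- ### integrate the majorant
  have htail := norm_setIntegral_compl_le_four measurableSet_Icc
    (SaddleKernel.integrable_kernelIntegrand hα0 x y hAc hAi) hb0 ha₀0 (by norm_num : (0 : ℝ) < 3) hT0 hA'0 hB0
    hB'0 hC0 hmaj
  refine htail.trans (le_of_eq ?_)
  -- evaluate the four closed forms
  have e1 : A' * Real.sqrt (Real.pi / b) = D * Real.sqrt (8 * Real.pi / (a * K)) / α := by
    rw [hA', hb]
    have : Real.pi / (a * (K / 2) / 4) = 8 * Real.pi / (a * K) := by field_simp; ring
    rw [this]; ring
  have e2 : B * Real.pi / a₀ = D * (2 * (2 : ℝ) ^ (-(K / 4)) * Real.pi / Real.sqrt a) / α := by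
    rw [hB, ha₀, show -(K / 2 / 2) = -(K / 4) by ring]
    have hsa : 0 < Real.sqrt a := Real.sqrt_pos.2 ha
    have hsa2 : Real.sqrt a * Real.sqrt a = a := Real.mul_self_sqrt ha.le
    field_simp
    nlinarith [hsa2]
  have e3 : B' * Real.pi / 3 = 6 * ε₁ * L := by rw [hB']; field_simp; ring
  have e4 : C * Real.pi / T = 2 * Real.pi / 3 * ε₂ * T + 2 * Real.pi * B₃ / T ^ 2 := by
    rw [hC]; field_simp
  rw [e1, e2, e3, e4]
  ring

/-! ### The analytic core, arbitrary saddle point -/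

set_option maxHeartbeats 1600000 in
/-- **The analytic core of Hildebrand–Tenenbaum's Theorem 1, arbitrary saddle point** (Gaussian-smoothed
Perron formula, Gaussian window, three tails and the Gaussian mean of `|ζ|`). Let `x > 1`, `y ≥ 2`,
`α = α(x,y) ≤ 1`, `φ = φ₂(α,y)`, `T_g ≥ 4`, `W > 0`, `τ = W/√φ`, `π/log y ≤ 1`, `T_d ≥ 3`, and suppose:
the near-axis bound `|ζ(α+it,y)| ≤ ζ(α,y)(1 + a t²)^{-K/2}` on `|t| ≤ π/log y` (`a > 0`, `K ≥ 4`); the decay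
`|ζ(α+it,y)| ≤ ε ζ(α,y)` on `π/log y ≤ |t| ≤ T_d`; the window smallness `φ₃τ³/6 + φ₄τ⁴ ≤ 1`. Then
`|x^{-α}Ψ(x,y) − ζ(α,y)/(α√(2πφ))| ≤ (α²/2T_g²)(ζ(α,y)/(α√(2πφ)) + ζ(α,y)(K_w + K_t)/2π) + ζ(α,y)(K_w + K_t)/2π`
`+ (4√(2π)/T_g) · (ζ(α,y)/2π)(√(4π/(aK)) + 2π2^{-K/2}/√a + 2εT_d + e^{-T_d²/T_g²}√(πT_g²))`, where `K_w`
bounds the window error of `norm_setIntegral_window_saddle_sub_main_le` for `A(t) = e^{-t²/2T_g²}/(α + it)`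
and `K_t` the tails of `norm_tailIntegral_le_general` with `ε₁ = ε₂ = ε`, `T = T_d`,
`B₃ = 4T_g² e^{-1} e^{-T_d²/4T_g²}`. [cite: HildebrandTenenbaum1986, Thm 1 (proof, §5) and §4 Lemmas 10–11] -/
theorem abs_rpow_mul_card_sub_main_le_general {x Tg W Td ε Kw Kt a K : ℝ} {y : ℕ} (hx : 1 < x) (hy : 2 ≤ y)
    (hα1 : saddlePoint x y ≤ 1) (hTg : 4 ≤ Tg) (hW : 0 < W)
    (hy1 : Real.pi / Real.log y ≤ 1)
    (hTd : 3 ≤ Td) (hε : 0 ≤ ε) (ha : 0 < a) (hK : 4 ≤ K)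
    (hnear : ∀ t : ℝ, |t| ≤ Real.pi / Real.log y →
      ‖smoothZetaC ((saddlePoint x y : ℂ) + t * I) y‖ ≤ smoothZeta (saddlePoint x y) y * (1 + a * t ^ 2) ^ (-(K / 2)))
    (hdec : ∀ t : ℝ, Real.pi / Real.log y ≤ |t| → |t| ≤ Td →
      ‖smoothZetaC ((saddlePoint x y : ℂ) + t * I) y‖ ≤ smoothZeta (saddlePoint x y) y * ε)
    (hsmall : saddlePhi₃ (saddlePoint x y) y / 6 * (W / Real.sqrt (saddlePhi₂ (saddlePoint x y) y)) ^ 3 +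
      saddlePhi₄ (saddlePoint x y) y * (W / Real.sqrt (saddlePhi₂ (saddlePoint x y) y)) ^ 4 ≤ 1)
    (hKw : ‖((saddlePoint x y : ℝ) : ℂ)⁻¹‖ *
          (Real.exp (-(saddlePhi₂ (saddlePoint x y) y / 4) * (W / Real.sqrt (saddlePhi₂ (saddlePoint x y) y)) ^ 2) *
            Real.sqrt (4 * Real.pi / saddlePhi₂ (saddlePoint x y) y)) +
        Real.sqrt (4 * Real.pi / saddlePhi₂ (saddlePoint x y) y) *
          (Real.exp 1 * (1 / saddlePoint x y ^ 3 + 1 / (2 * Tg ^ 2 * saddlePoint x y)) *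
              (4 * 1 / (Real.exp 1 * saddlePhi₂ (saddlePoint x y) y)) ^ 1 +
            (‖((saddlePoint x y : ℝ) : ℂ)⁻¹‖ * saddlePhi₄ (saddlePoint x y) y +
                ‖-I / ((saddlePoint x y : ℝ) : ℂ) ^ 2‖ *
                  (saddlePhi₃ (saddlePoint x y) y / 3 + saddlePhi₄ (saddlePoint x y) y)) *
              (4 * 2 / (Real.exp 1 * saddlePhi₂ (saddlePoint x y) y)) ^ 2 +
            (‖((saddlePoint x y : ℝ) : ℂ)⁻¹‖ * saddlePhi₃ (saddlePoint x y) y ^ 2 / 18 +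
                ‖-I / ((saddlePoint x y : ℝ) : ℂ) ^ 2‖ * saddlePhi₄ (saddlePoint x y) y) *
              (4 * 3 / (Real.exp 1 * saddlePhi₂ (saddlePoint x y) y)) ^ 3 +
            2 * ‖((saddlePoint x y : ℝ) : ℂ)⁻¹‖ * saddlePhi₄ (saddlePoint x y) y ^ 2 *
              (4 * 4 / (Real.exp 1 * saddlePhi₂ (saddlePoint x y) y)) ^ 4) ≤ Kw)
    (hKt : (1 + a * (W / Real.sqrt (saddlePhi₂ (saddlePoint x y) y)) ^ 2) ^ (-(K / 4)) *
          (Real.sqrt (8 * Real.pi / (a * K)) + 2 * (2 : ℝ) ^ (-(K / 4)) * Real.pi / Real.sqrt a) / saddlePoint x y +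
        6 * ε * Real.log y + 2 * Real.pi / 3 * ε * Td +
        2 * Real.pi * (4 * Tg ^ 2 * Real.exp (-1) * Real.exp (-(Td ^ 2 / (4 * Tg ^ 2)))) / Td ^ 2 ≤ Kt) :
    |x ^ (-saddlePoint x y) * ((Nat.smoothNumbersUpTo ⌊x⌋₊ (y + 1)).card : ℝ) -
        smoothZeta (saddlePoint x y) y /
          (saddlePoint x y * Real.sqrt (2 * Real.pi * saddlePhi₂ (saddlePoint x y) y))| ≤
      saddlePoint x y ^ 2 / (2 * Tg ^ 2) *
          (smoothZeta (saddlePoint x y) y /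
              (saddlePoint x y * Real.sqrt (2 * Real.pi * saddlePhi₂ (saddlePoint x y) y)) +
            smoothZeta (saddlePoint x y) y / (2 * Real.pi) * (Kw + Kt)) +
        smoothZeta (saddlePoint x y) y / (2 * Real.pi) * (Kw + Kt) +
        4 * Real.sqrt (2 * Real.pi) / Tg * (1 / (2 * Real.pi) * (smoothZeta (saddlePoint x y) y *
          (Real.sqrt (Real.pi / (a * K / 4)) + (2 * (2 : ℝ) ^ (-(K / 2)) / a) * Real.pi / (1 / Real.sqrt a) +
            ε * (2 * Td) + Real.exp (-(Td ^ 2 / Tg ^ 2)) * Real.sqrt (Real.pi / (1 / Tg ^ 2))))) := by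
  set α : ℝ := saddlePoint x y with hαdef
  have hα0 : 0 < α := saddlePoint_pos hx hy
  have hx0 : 0 < x := by linarith
  set φ : ℝ := saddlePhi₂ α y with hφdef
  have hφ0 : 0 < φ := saddlePhi₂_pos hy hα0
  set ζ₀ : ℝ := smoothZeta α y with hζ₀
  have hζ0 : 0 < ζ₀ := smoothZeta_pos hα0
  set L : ℝ := Real.log y with hL
  have hL0 : 0 < L := Real.log_pos (by exact_mod_cast lt_of_lt_of_le one_lt_two hy)
  have hTg0 : 0 < Tg := by linarith
  have hTd0 : 0 < Td := by linarith
  have hαTg : α ≤ Tg / 2 := by linarith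
  set τ : ℝ := W / Real.sqrt φ with hτdef
  have hτ0 : 0 < τ := div_pos hW (Real.sqrt_pos.2 hφ0)
  set A : ℝ → ℂ := kernelA α Tg with hA
  have hAc : Continuous A := continuous_kernelA hα0 Tg
  have hAi : Integrable A := integrable_kernelA hα0 hTg0
  set f : ℝ → ℂ := SaddleKernel.kernelIntegrand x α y A with hf
  have hfi : Integrable f := SaddleKernel.integrable_kernelIntegrand hα0 x y hAc hAi
  have hK2 : 2 ≤ K := by linarith
  -- (1) the smoothed Perron formula
  have hF3 := GaussPerron.card_smooth_gaussPerron_integral hx.le hα0 hTg0 hαTg y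
  have hI := integral_perronDamping_eq hα0 Tg hx0 y
  rw [hI] at hF3
  -- (2) the Gaussian mean of `|ζ|`
  have hJ := integral_norm_le_general (y := y) α hTg0 (L := L) ha hK2 hε hTd0 hζ0.le
    (fun t => norm_smoothZetaC_le hα0 t y) (fun t ht => hnear t ht) (fun t ht1 ht2 => hdec t ht1 ht2)
  -- (3) the window
  have hB₂0 : 0 ≤ 1 / α ^ 3 + 1 / (2 * Tg ^ 2 * α) := by positivity
  have hwin := norm_setIntegral_window_saddle_sub_main_le (A := A) (A₀ := ((α : ℝ) : ℂ)⁻¹) (A₁ := -I / ((α : ℝ) : ℂ) ^ 2)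
    (B₂ := 1 / α ^ 3 + 1 / (2 * Tg ^ 2 * α)) (τ := τ) hx hy hτ0.le hB₂0 hAc
    (fun t _ => norm_kernelA_sub_taylor_le hα0 hTg0 t) hsmall
  -- (4) the tails
  have hB₃0 : 0 ≤ 4 * Tg ^ 2 * Real.exp (-1) * Real.exp (-(Td ^ 2 / (4 * Tg ^ 2))) := by positivity
  have htail := norm_tailIntegral_le_general (x := x) (y := y) (T := Td) (ε₁ := ε) (ε₂ := ε)
    (B₃ := 4 * Tg ^ 2 * Real.exp (-1) * Real.exp (-(Td ^ 2 / (4 * Tg ^ 2)))) (W := W) (a := a) (K := K)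
    hx hy hφ0 hTg0 hW hy1 hTd hε hε ha hK hnear
    (fun t ht1 ht2 => by
      rw [div_le_iff₀ hζ0]; have := hdec t ht1 (ht2.trans hTd); linarith)
    (fun t ht1 ht2 => by
      rw [div_le_iff₀ hζ0]; have := hdec t (hy1.trans ((show (1 : ℝ) ≤ 3 by norm_num).trans ht1)) ht2; linarith)
    hB₃0 (fun t ht => norm_kernelA_le_div_cube α hTg0 hTd0 ht)
  -- (5) `K = ∫_{window} + ∫_{tails}` and `‖K - α⁻¹ √(2π/φ)‖ ≤ K_w + K_t`
  set KK : ℂ := ∫ t, f t with hKK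
  have hsplit : (∫ t in Set.Icc (-τ) τ, f t) + ∫ t in (Set.Icc (-τ) τ)ᶜ, f t = KK :=
    integral_add_compl measurableSet_Icc hfi
  set main : ℂ := ((α : ℝ) : ℂ)⁻¹ * ((Real.sqrt (2 * Real.pi / φ) : ℝ) : ℂ) with hmain
  have hKmain : ‖KK - main‖ ≤ Kw + Kt := by
    have h1 : KK - main = ((∫ t in Set.Icc (-τ) τ, f t) - main) + ∫ t in (Set.Icc (-τ) τ)ᶜ, f t := by
      rw [← hsplit]; ring
    rw [h1]
    exact (norm_add_le _ _).trans (add_le_add (hwin.trans hKw) (htail.trans hKt))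
  -- (6) real parts
  have hmain_re : main.re = α⁻¹ * Real.sqrt (2 * Real.pi / φ) := by
    rw [hmain, ← Complex.ofReal_inv, ← Complex.ofReal_mul, Complex.ofReal_re]
  have hIre : ((((ζ₀ / (2 * Real.pi) : ℝ)) : ℂ) * KK).re = ζ₀ / (2 * Real.pi) * KK.re := Complex.re_ofReal_mul _ _
  set δ : ℝ := ζ₀ / (2 * Real.pi) * (KK - main).re with hδ
  have hKre : ζ₀ / (2 * Real.pi) * KK.re = ζ₀ / (α * Real.sqrt (2 * Real.pi * φ)) + δ := by
    have : KK.re = main.re + (KK - main).re := by simp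
    rw [this, hmain_re, mul_add, hδ]
    congr 1
    rw [show ζ₀ / (2 * Real.pi) * (α⁻¹ * Real.sqrt (2 * Real.pi / φ)) =
      ζ₀ * (1 / (2 * Real.pi) * (α⁻¹ * Real.sqrt (2 * Real.pi / φ))) by ring, sqrt_div_div_eq hφ0 hα0]
    ring
  have hδle : |δ| ≤ ζ₀ / (2 * Real.pi) * (Kw + Kt) := by
    rw [hδ, abs_mul, abs_of_pos (by positivity : 0 < ζ₀ / (2 * Real.pi))]
    exact mul_le_mul_of_nonneg_left ((Complex.abs_re_le_norm _).trans hKmain) (by positivity)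
  -- (7) assemble
  set m : ℝ := ζ₀ / (α * Real.sqrt (2 * Real.pi * φ)) with hm
  have hm0 : 0 ≤ m := by positivity
  set s : ℝ := α ^ 2 / (2 * Tg ^ 2) with hs
  set P : ℝ := x ^ (-α) * ((Nat.smoothNumbersUpTo ⌊x⌋₊ (y + 1)).card : ℝ) with hP
  set Δ : ℝ := ζ₀ / (2 * Real.pi) * (Kw + Kt) with hΔ
  rw [hIre, hKre] at hF3
  have hR := le_trans hF3 (mul_le_mul_of_nonneg_left hJ (by positivity))
  have he1 : Real.exp (-s) ≤ 1 := Real.exp_le_one_iff.2 (neg_nonpos.2 (by positivity))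
  have he2 : 1 - Real.exp (-s) ≤ s := LFunctions.PrimeReciprocal.one_sub_exp_neg_le s
  have hkey : P - m = (P - Real.exp (-s) * (m + δ)) + (Real.exp (-s) - 1) * (m + δ) + δ := by ring
  rw [hkey]
  have hA1 : |P - Real.exp (-s) * (m + δ) + (Real.exp (-s) - 1) * (m + δ) + δ| ≤
      |P - Real.exp (-s) * (m + δ)| + |(Real.exp (-s) - 1) * (m + δ)| + |δ| := by
    refine (abs_add_le _ _).trans ?_
    linarith [abs_add_le (P - Real.exp (-s) * (m + δ)) ((Real.exp (-s) - 1) * (m + δ))]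
  have h2 : |(Real.exp (-s) - 1) * (m + δ)| ≤ s * (m + Δ) := by
    rw [abs_mul, show |Real.exp (-s) - 1| = 1 - Real.exp (-s) by rw [abs_sub_comm]; exact abs_of_nonneg (by linarith)]
    refine mul_le_mul he2 ((abs_add_le _ _).trans ?_) (abs_nonneg _) (by positivity)
    rw [abs_of_nonneg hm0]; linarith
  have h3 : |δ| ≤ Δ := hδle
  linarith [hA1, hR, h2, h3]

end GaussSaddle

end Literature.NumberTheory.Sieve

end
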